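import Summits.BirchSwinnertonDyer.BirchSwinnertonDyer.Theorems.GenusKolyvaginAtTwoGenusPrimitiveSupplyAtTwoPrimeHeegnerTwinRowOne
import Summits.BirchSwinnertonDyer.BirchSwinnertonDyer.Theorems.GenusKolyvaginAtTwoGenusPrimitiveSupplyAtTwoPrimeHeegnerTwinStubA
import Summits.BirchSwinnertonDyer.Rank1Residual.F1Sign2.DescentSignShaAtTwo
import Literature.NumberTheory.EllipticCurves.TwoTorsionOddDegreeBaseChangeProofs
import Literature.NumberTheory.EllipticCurves.TwistFamilySelmerGroupCardInvarianceProofs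
import Literature.NumberTheory.QuadraticFields.KroneckerSplitting
import Literature.NumberTheory.EllipticCurves.BSDSelmerCMPConverseRankOneProofs
import Literature.NumberTheory.EllipticCurves.NonEisensteinPrimeOfSurjective
import HarnessLib

/-!
# Route `GenusKolyvaginAtTwo`, crux `GenusPrimitiveSupplyAtTwo` (stmt-BirchSwinnertonDyer-22136):
# the `Δ > 0` half of the DEF = 1 supply — SILENT prime Heegner fields, and the descent sign decides

Seat `bsd-line-gk2-p5` g7 (cell `bsd-f1-sign2`), SUPPLY lineage (g0 `…TwinSupply*`, g2 `…HeegnerTwin*`, g6 `…LocalTwoTorsion`,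
`…PrimeHeegnerTwin{,StubA,Dichotomy,RowOne}`). Summit-side THEOREM-ONLY file (no definition, no named fact, no `sorry`),
`--supports stmt-BirchSwinnertonDyer-22136`. It closes the lineage's open point (R-c) of `Lines/genus-supply-prime-heegner.md`:
the supply of a «DEF(W,K) = 1» admissible Heegner field with a Sel₂-minimal twin for habitat curves with `Δ_W > 0`.

SETTING. `DEF(E,K) = Σ_{q∣d_K} dim Ẽ(𝔽_q)[2] + [Δ_E > 0]` (lead gk2-p1 g4 / U-LEDGER): on `Δ_E > 0` the real place is
the odd place, so «DEF = 1» means EVERY prime `q ∣ d_K` is SILENT (`ψ` has no root mod `q`). For a silent prime the twist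
`E ↦ E^{(−ℓ)}` changes no finite local condition of `Sel₂` (`H¹(ℚ_ℓ, E[2]) = 0`; bad primes and `2` split) and changes the
REAL one (Kramer 1981 Prop. 6 `i_∞ = [Δ > 0]`; Mazur–Rubin 2010 Lemma 2.9 «even if `v ∣ ∞`», proof of Prop. 5.3 with `v₀`
real): `d₂(E^{(−ℓ)}) = d₂(E) ± 1`, the SIGN being whether `Sel₂(E)` is strict at `∞` — a property of `E` ALONE, the cell's
descent sign `ε(E)` (lens `-desc`: typed statements `F1Sign2.AdmissibleTwistSelmerShiftAtTwo` = T-A and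
`F1Sign2.StrictShaPropagationAtTwo` = T-V of `F1Sign2/DescentSignAtTwo.lean`, REF1-audited, «in print as mathematics» per
REF2-PLACEMENT-v5 §1), taken BY NAME below exactly as g6 took `MazurRubin2010.prop33_rat` / `cor34i_singleton_rat` on
`Δ < 0` (those do not apply here: MR's splitting list asks the real place to split when `Δ > 0`).

THIS FILE. §1 `silent_iff_odd_frobeniusTrace`: for odd `ℓ ∤ Δ_min`, `ψ` has no root mod `ℓ` ⟺ `a_ℓ(W)` odd — the bridge
between this lineage's root-count currency, `-desc`'s `DescAdmissible` («`a_q` odd») and Mazur–Rubin's `E(ℚ_q)[2] = 0` (g6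
`twoTorsion_padic_eq_zero_of_forall_ne`). §2 `descAdmissible_neg_prime_of_silent`, `exists_silent_heegnerField_of_prime`: a
silent prime `ℓ ≡ 7 (8)`, `ℓ ≡ −1 (p ∣ N_W odd)` gives `F1Sign2.DescAdmissible W (−ℓ)` AND the field `ℚ(√−ℓ)` with every
K-clause of crux 22136, `2` split, `E(ℚ_ℓ)[2] = 0`. §3 `supply_DEF1_posDisc_of_shift` (mod T-A): on `{Δ > 0, E(ℚ)[2] = 0,
#Sel₂(W) = 1}` EVERY silent admissible prime gives a DEF = 1 field with a globally minimal twin `Wd`, `#Sel₂(Wd) = 2` (the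
`Δ > 0` companion of g6 `supply_DEF1_of_strict_free_prime`). §4 `descAdmissible_discr_of_forall_silent`: every admissible
Heegner field with `2` split and all primes silent (= every DEF = 1 field on `Δ > 0`) has a `-desc`-admissible discriminant;
`supply_DEF1_posDisc_rowOne_dichotomy` (mod T-V): on row 1 (`rank 0`, `#Sel₂(W) = 4`, `Δ > 0`) EITHER every silent admissible
prime supplies a Sel₂-minimal twin OR the twin at every DEF = 1 field has `#Sel₂ = 8`; `no_minimalTwin_of_descentSignNeg`: the
second branch is `F1Sign2.DescentSignNeg W` (ε(W) = −1). §5: the same under the binders of crux 22136.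

CONSISTENCY FINDING #3 (for the pen's re-typing of 24947 / `MinimalTwinSupplyDEF1`; extends gk2-p4 g6 FINDING #2): on the
cells {Δ > 0, #Sel₂(E) = 4, ε(E) = −1} NO DEF = 1 Heegner field has a Sel₂-minimal twin (mod T-V), so — with the BSD-side
«DEF ≥ 3 ⟹ no certificate» of the U-LEDGER — every typing that asks ONE `K` for both a certificate and `#Sel₂(Wd) = 2` is
unsatisfiable there; the clause `Nat.card (W.selmerGroup 2) ≤ 4` (V14a) does not remove these cells. On `Δ < 0` the sign
is a Čebotarev-open condition on `ℓ` (g6 `natCard_selmerGroup_twin_eq_two_iff_not_strict`); on `Δ > 0` it is NOT.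
NOT here: the existence of silent admissible primes (Čebotarev in `ℚ(E[2], ζ_{8N})`, non-abelian: `a_ℓ` odd is «Frob_ℓ of
order 3 on E[2]»), the twin's analytic rank, anything about the certificate. BSD is not proved by any of this.

References: [Kramer1981] Props. 3, 6; [MazurRubin2010] Lemmas 2.2 (i), 2.9–2.11, Prop. 3.3, Prop. 5.3 (proof, `v₀` real);
[CremonaMazur2000] §3; [SilvermanAEC2009] III.2.3 (d), Ex. III.3.7 (d), V.2, X.4.2; [Mazur1977] III §5; [GrossLMS1991] §1.
-/

set_option linter.dupNamespace false -- tree convention: `Summit.BirchSwinnertonDyer.BirchSwinnertonDyer.Theorems` (summit = sub-problem)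
set_option autoImplicit false

noncomputable section

open scoped Classical

open NumberField WeierstrassCurve Literature.NumberTheory.EllipticCurves Literature.NumberTheory.QuadraticFields
open Summit.BirchSwinnertonDyer.Rank1Residual.F1Sign2

namespace Summit.BirchSwinnertonDyer.BirchSwinnertonDyer.Theorems.GenusKolyTwin

variable (W : WeierstrassCurve ℚ) [W.IsElliptic] [W.IsGloballyMinimal]

/-! ## §1. Silent primes: no root of `ψ` mod `ℓ` ⟺ `a_ℓ` odd -/

/-- A finite abelian group has no element of order `2` iff its order is odd (Cauchy / Lagrange). [folklore] -/
theorem forall_two_nsmul_eq_zero_iff_odd_natCard {A : Type*} [AddCommGroup A] [Finite A] :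
    (∀ a : A, 2 • a = 0 → a = 0) ↔ Odd (Nat.card A) := by
  classical
  haveI := Fintype.ofFinite A
  rw [Nat.card_eq_fintype_card, ← Nat.not_even_iff_odd, even_iff_two_dvd]
  constructor
  · intro h hdvd
    haveI : Fact (Nat.Prime 2) := ⟨Nat.prime_two⟩
    obtain ⟨a, ha⟩ := exists_prime_addOrderOf_dvd_card 2 hdvd
    have h2a : 2 • a = 0 := by rw [← ha]; exact addOrderOf_nsmul_eq_zero a
    have := h a h2a
    rw [this, addOrderOf_zero] at ha
    exact absurd ha (by norm_num)
  · intro h a ha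
    by_contra hne
    apply h
    have hord : addOrderOf a = 2 := by
      have h1 := addOrderOf_dvd_of_nsmul_eq_zero ha
      have h2 : addOrderOf a ≠ 1 := by rwa [Ne, AddMonoid.addOrderOf_eq_one_iff]
      have : addOrderOf a ∣ 2 := h1
      rcases (Nat.dvd_prime Nat.prime_two).mp this with h | h
      · exact absurd h h2
      · exact h
    rw [← hord]
    exact addOrderOf_dvd_card

omit [W.IsElliptic] in
/-- **Silent ⟺ `a_ℓ` odd.** For `W/ℚ` globally minimal elliptic and an odd prime `ℓ ∤ Δ_min(W)`: the `2`-division cubic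
`ψ = 4x³ + b₂x² + 2b₄x + b₆` of the minimal model has NO root mod `ℓ` iff `a_ℓ(W)` is odd (`ψ̄` has a root iff `Ẽ(𝔽_ℓ)` has a
point of order `2` iff `#Ẽ(𝔽_ℓ) = ℓ + 1 − a_ℓ` is even). [cite: SilvermanAEC2009, Ex. III.3.7 (d) and V.2 (a_p = p + 1 − #Ẽ(𝔽_p))] -/
theorem silent_iff_odd_frobeniusTrace {ℓ : ℕ} [Fact ℓ.Prime] (hℓ2 : ℓ ≠ 2)
    (hℓΔ : ¬ (ℓ : ℤ) ∣ minimalDiscriminantInt W) :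
    (∀ x : ZMod ℓ, 4 * x ^ 3 + ((integralModelInt W).b₂ : ZMod ℓ) * x ^ 2 +
        2 * ((integralModelInt W).b₄ : ZMod ℓ) * x + ((integralModelInt W).b₆ : ZMod ℓ) ≠ 0) ↔
      Odd (W.frobeniusTrace ℓ) := by
  have hℓ : ℓ.Prime := Fact.out
  set M : WeierstrassCurve (ZMod ℓ) := (integralModelInt W).map (Int.castRingHom (ZMod ℓ)) with hM
  haveI hME : M.IsElliptic := by
    rw [hM, isElliptic_iff, map_Δ, isUnit_iff_ne_zero, eq_intCast, Ne, ZMod.intCast_zmod_eq_zero_iff_dvd]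
    exact hℓΔ
  have h2 : (2 : ZMod ℓ) ≠ 0 := by
    have : ((2 : ℕ) : ZMod ℓ) ≠ 0 := by
      rw [Ne, ZMod.natCast_eq_zero_iff]
      intro h
      exact hℓ2 ((Nat.prime_dvd_prime_iff_eq hℓ Nat.prime_two).mp h)
    exact_mod_cast this
  -- roots of `ψ mod ℓ` are the roots of the `2`-division cubic of the reduced curve `M`
  have hroot : ∀ x : ZMod ℓ, (4 * x ^ 3 + ((integralModelInt W).b₂ : ZMod ℓ) * x ^ 2 +
      2 * ((integralModelInt W).b₄ : ZMod ℓ) * x + ((integralModelInt W).b₆ : ZMod ℓ) = 0 ↔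
        M.twoTorsionPolynomial.toPoly.IsRoot x) := by
    intro x
    rw [← isRoot_twoTorsionPolynomial_map_zmod_iff W x, hM, WeierstrassCurve.map_twoTorsionPolynomial,
      Cubic.map_toPoly]
  -- `a_ℓ` odd iff `#M(𝔽_ℓ)` odd
  have hodd : Odd ℓ := hℓ.odd_of_ne_two hℓ2
  have hcount : Odd (W.frobeniusTrace ℓ) ↔ Odd (Nat.card M.toAffine.Point) := by
    have h1 : Even ((ℓ : ℤ) + 1) := by
      obtain ⟨k, hk⟩ := hodd
      exact ⟨k + 1, by push_cast [hk]; ring⟩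
    rw [WeierstrassCurve.frobeniusTrace, WeierstrassCurve.reductionPointCount, Int.odd_sub', ← hM]
    exact ⟨fun h => by exact_mod_cast h.mpr h1, fun h => iff_of_true (by exact_mod_cast h) h1⟩
  have hlhs : (∀ x : ZMod ℓ, 4 * x ^ 3 + ((integralModelInt W).b₂ : ZMod ℓ) * x ^ 2 +
      2 * ((integralModelInt W).b₄ : ZMod ℓ) * x + ((integralModelInt W).b₆ : ZMod ℓ) ≠ 0) ↔
        ∀ x : ZMod ℓ, ¬ M.twoTorsionPolynomial.toPoly.IsRoot x :=
    forall_congr' fun x => not_congr (hroot x)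
  rw [hlhs, ← M.forall_two_nsmul_iff_forall_not_isRoot_twoTorsionPolynomial h2]
  -- the two `AddCommGroup` structures on `M(𝔽_ℓ)` differ only in the `DecidableEq (ZMod ℓ)` instance used
  convert (forall_two_nsmul_eq_zero_iff_odd_natCard (A := M.toAffine.Point)).trans hcount.symm

/-! ## §2. A silent prime Heegner field is a descent-admissible (`-desc`) twist parameter -/

/-- **Silent prime Heegner fields are `DescAdmissible`.** For `W/ℚ` globally minimal elliptic and a SILENT prime `ℓ ≡ 7 (mod 8)`
with `ℓ ≡ −1 (mod p)` for every odd prime `p ∣ N_W` (no root of the `2`-division cubic mod `ℓ`): `d = −ℓ` is a `-desc`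
descent-admissible twist parameter (`d < 0`, squarefree, `d ≡ 1 (8)`, its prime good with `a_ℓ` odd, `(d/p) = 1` at odd bad `p`);
on `Δ_W > 0` these are exactly the prime Heegner fields with DEF(W,K) = 1. [cite: Kramer1981, Prop. 3] [cite: GrossLMS1991, §1 (p. 235)] -/
theorem descAdmissible_neg_prime_of_silent {ℓ : ℕ} (hℓ : ℓ.Prime) (hℓ8 : ℓ % 8 = 7)
    (hℓN : ∀ p : ℕ, p.Prime → p ∣ W.conductorNorm ℤ → p ≠ 2 → (ℓ : ZMod p) = -1)
    (hsilent : ∀ x : ZMod ℓ, 4 * x ^ 3 + ((integralModelInt W).b₂ : ZMod ℓ) * x ^ 2 +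
        2 * ((integralModelInt W).b₄ : ZMod ℓ) * x + ((integralModelInt W).b₆ : ZMod ℓ) ≠ 0) :
    DescAdmissible W (-(ℓ : ℤ)) := by
  haveI := Fact.mk hℓ
  obtain ⟨-, hℓΔ, -⟩ := exists_heegnerField_of_prime W hℓ hℓ8 hℓN
  have hℓ2 : ℓ ≠ 2 := by omega
  have hℓ8' : (ℓ : ℤ) % 8 = 7 := by exact_mod_cast hℓ8
  refine ⟨by have := hℓ.pos; omega, ?_, by omega, ?_, ?_⟩
  · rw [← Int.squarefree_natAbs]
    simpa using hℓ.squarefree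
  · intro q hq hqd
    have hqℓ : q = ℓ := by
      have h' : (q : ℤ) ∣ (ℓ : ℤ) := Int.dvd_neg.mp hqd
      exact (Nat.prime_dvd_prime_iff_eq hq hℓ).mp (by exact_mod_cast h')
    subst hqℓ
    exact ⟨fun _ => hasGoodReductionAtPrime_of_not_dvd W q hℓΔ, (silent_iff_odd_frobeniusTrace W hℓ2 hℓΔ).mp hsilent⟩
  · intro p hp hp2 hbad
    haveI := Fact.mk hp
    have hpN : p ∣ W.conductorNorm ℤ := (W.dvd_conductorNorm_iff_not_hasGoodReductionAtPrime p).mpr (hbad ⟨hp⟩)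
    have h1 : (ℓ : ZMod p) = -1 := hℓN p hp hpN hp2
    have hmod : (-(ℓ : ℤ)) % (p : ℤ) = 1 % (p : ℤ) := by
      have h' : ((-(ℓ : ℤ) : ℤ) : ZMod p) = ((1 : ℤ) : ZMod p) := by push_cast; rw [h1, neg_neg]
      exact (ZMod.intCast_eq_intCast_iff' _ _ _).mp h'
    rw [jacobiSym.mod_left, hmod, ← jacobiSym.mod_left, jacobiSym.one_left]

/-- **Every K-clause of crux 22136 + `-desc` admissibility + `E(ℚ_ℓ)[2] = 0`** for a silent prime Heegner field `K = ℚ(√−ℓ)`: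
imaginary quadratic, `d_K = −ℓ` odd `≠ −3`, Heegner for `N_W`, `2` split, the two non-square clauses, `DescAdmissible W (−ℓ)`, and
`E(ℚ_ℓ)[2] = 0` (Mazur–Rubin's «`ℓ ∉ T`»: the local condition at `ℓ` is empty).
[cite: MazurRubin2010, Lemma 2.2 (i) and Cor. 3.4 (ii)] [cite: GrossLMS1991, §1 (p. 235)] -/
theorem exists_silent_heegnerField_of_prime {ℓ : ℕ} (hℓ : ℓ.Prime) (hℓ8 : ℓ % 8 = 7)
    (hℓN : ∀ p : ℕ, p.Prime → p ∣ W.conductorNorm ℤ → p ≠ 2 → (ℓ : ZMod p) = -1)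
    (hsilent : ∀ x : ZMod ℓ, 4 * x ^ 3 + ((integralModelInt W).b₂ : ZMod ℓ) * x ^ 2 +
        2 * ((integralModelInt W).b₄ : ZMod ℓ) * x + ((integralModelInt W).b₆ : ZMod ℓ) ≠ 0) :
    DescAdmissible W (-(ℓ : ℤ)) ∧
    (∀ [Fact ℓ.Prime], ∀ Q : (W.baseChange ℚ_[ℓ]).toAffine.Point, 2 • Q = 0 → Q = 0) ∧
    ∃ (K : Type) (_ : Field K) (_ : NumberField K), IsImaginaryQuadratic K ∧ discr K = -(ℓ : ℤ) ∧ Odd (discr K) ∧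
      discr K ≠ -3 ∧ SatisfiesHeegnerHypothesis (W.conductorNorm ℤ) K ∧
      ((Ideal.span {(2 : ℤ)}).primesOver (𝓞 K)).ncard = 2 ∧
      ¬ IsSquare ((discr K : ℚ) * -|W.Δ|) ∧ ¬ IsSquare ((discr K : ℚ) * (-(2 * |W.Δ|))) := by
  obtain ⟨hℓN', hℓΔ, hK⟩ := exists_heegnerField_of_prime W hℓ hℓ8 hℓN
  have hℓ2 : ℓ ≠ 2 := by omega
  exact ⟨descAdmissible_neg_prime_of_silent W hℓ hℓ8 hℓN hsilent,
    fun Q hQ => twoTorsion_padic_eq_zero_of_forall_ne W hℓ2 hℓΔ hsilent Q hQ, hK⟩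

/-! ## §3. `{Δ > 0, #Sel₂(E) = 1}`: every silent prime Heegner field supplies a Sel₂-minimal twin (mod T-A) -/

omit [W.IsGloballyMinimal] in
/-- `#Sel₂` of ANY elliptic model of the twist `W^{(d)}` is `-desc`'s `twistSelmerTwoCard W d` (the `2`-Selmer group is an
isomorphism invariant: tree `natCard_selmerGroup_smul`). [cite: SilvermanAEC2009, Thm. X.4.2 with III.3.1(b)] -/
theorem natCard_selmerGroup_model_eq_twistSelmerTwoCard {d : ℤ} (hd0 : d ≠ 0) (Wd : WeierstrassCurve ℚ) [Wd.IsElliptic]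
    (hWd : ∃ C : VariableChange ℚ, C • W.quadraticTwist (d : ℚ) = Wd) :
    Nat.card (Wd.selmerGroup 2) = twistSelmerTwoCard W d := by
  obtain ⟨C, hC⟩ := hWd
  haveI := W.isElliptic_quadraticTwist (show ((d : ℤ) : ℚ) ≠ 0 by exact_mod_cast hd0)
  have hsm := natCard_selmerGroup_smul (W.quadraticTwist ((d : ℤ) : ℚ)) C (n := 2) two_ne_zero
  simp only [Nat.cast_ofNat] at hsm
  rw [← hC, hsm, twistSelmerTwoCard]

/-- **SUPPLY″-Selmer on `{Δ_W > 0, #Sel₂(W) = 1}`** (mod T-A `F1Sign2.AdmissibleTwistSelmerShiftAtTwo` BY NAME — Kramer 1981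
Prop. 6, tree `Kramer1981.prop6_archimedeanNormIndex_holds`, + Mazur–Rubin 2010 Lemmas 2.10/2.11 + the Prop. 3.3 count with
`T = {∞}`). `W/ℚ` globally minimal elliptic, `Δ_W > 0`, no rational `2`-torsion abscissa, `#Sel₂(W) = 1`; `ℓ ≡ 7 (8)`,
`ℓ ≡ −1 (p ∣ N_W odd)` SILENT ⟹ `K = ℚ(√−ℓ)` has every K-clause of crux 22136, `2` split, `E(ℚ_ℓ)[2] = 0` (DEF = 1), and a
GLOBALLY MINIMAL twin `Wd ≅ W^{(−ℓ)}` with `#Sel₂(Wd) = 2` (`∈ {1/2, 2}`). The `Δ > 0` companion of `supply_DEF1_of_strict_free_prime`.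
[cite: Kramer1981, Prop. 6] [cite: MazurRubin2010, Lemma 2.10, Lemma 2.11, Prop. 3.3] -/
theorem supply_DEF1_posDisc_of_shift (hA : AdmissibleTwistSelmerShiftAtTwo) (hΔ : 0 < W.Δ)
    (ht : NoRationalTwoTorsion W) (h1 : Nat.card (W.selmerGroup 2) = 1) {ℓ : ℕ} (hℓ : ℓ.Prime) (hℓ8 : ℓ % 8 = 7)
    (hℓN : ∀ p : ℕ, p.Prime → p ∣ W.conductorNorm ℤ → p ≠ 2 → (ℓ : ZMod p) = -1)
    (hsilent : ∀ x : ZMod ℓ, 4 * x ^ 3 + ((integralModelInt W).b₂ : ZMod ℓ) * x ^ 2 +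
        2 * ((integralModelInt W).b₄ : ZMod ℓ) * x + ((integralModelInt W).b₆ : ZMod ℓ) ≠ 0) :
    ∃ (K : Type) (_ : Field K) (_ : NumberField K), IsImaginaryQuadratic K ∧ discr K = -(ℓ : ℤ) ∧ Odd (discr K) ∧
      discr K ≠ -3 ∧ SatisfiesHeegnerHypothesis (W.conductorNorm ℤ) K ∧
      ¬ IsSquare ((discr K : ℚ) * -|W.Δ|) ∧ ¬ IsSquare ((discr K : ℚ) * (-(2 * |W.Δ|))) ∧
      ((Ideal.span {(2 : ℤ)}).primesOver (𝓞 K)).ncard = 2 ∧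
      (∀ [Fact ℓ.Prime], ∀ Q : (W.baseChange ℚ_[ℓ]).toAffine.Point, 2 • Q = 0 → Q = 0) ∧
      ∃ (Wd : WeierstrassCurve ℚ) (_ : Wd.IsElliptic) (_ : Wd.IsGloballyMinimal),
        (∃ C : VariableChange ℚ, C • W.quadraticTwist (discr K : ℚ) = Wd) ∧ Nat.card (Wd.selmerGroup 2) = 2 := by
  obtain ⟨hDA, hloc, K, _, _, hK, hd, hodd, hd3, hH, h2K, hsq1, hsq2⟩ :=
    exists_silent_heegnerField_of_prime W hℓ hℓ8 hℓN hsilent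
  have htwist : twistSelmerTwoCard W (-(ℓ : ℤ)) = 2 := by
    rcases hA W hΔ ht (-(ℓ : ℤ)) hDA with h | h
    · rw [selmerTwoCard, h1] at h
      omega
    · rw [h, selmerTwoCard, h1]
  have hd0 : ((discr K : ℤ) : ℚ) ≠ 0 := by exact_mod_cast NumberField.discr_ne_zero K
  haveI := W.isElliptic_quadraticTwist hd0
  obtain ⟨C, hC⟩ := hasGlobalMinimalModel_rat_holds (W.quadraticTwist ((discr K : ℤ) : ℚ))
  haveI := hC
  refine ⟨K, inferInstance, inferInstance, hK, hd, hodd, hd3, hH, hsq1, hsq2, h2K, hloc,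
    C • W.quadraticTwist ((discr K : ℤ) : ℚ), inferInstance, hC, ⟨C, rfl⟩, ?_⟩
  rw [natCard_selmerGroup_model_eq_twistSelmerTwoCard W (NumberField.discr_ne_zero K) _ ⟨C, rfl⟩, hd, htwist]

/-! ## §4. ROW 1 (`#Sel₂(E) = 4`) on `Δ > 0`: a dichotomy decided by `E`, not by the choice of `K` (mod T-V) -/

variable {K : Type} [Field K] [NumberField K]

/-- **A Heegner field all of whose primes are silent is descent-admissible.** `K` imaginary quadratic with odd `d_K`, Heegner
for `N_W`, `2` split, and NO root of the `2`-division cubic modulo every prime of `d_K` (on `Δ_W > 0`: «DEF(W,K) = 1») ⟹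
`F1Sign2.DescAdmissible W d_K` (squarefree: odd fundamental; `≡ 1 (8)`: `2` split; primes of `d_K` are prime to `N_W` (Heegner),
so good, and silent ⟺ `a_q` odd by §1; odd bad primes divide `N_W`, so split: `(d_K/p) = 1`).
[cite: Kramer1981, Prop. 3] [cite: GrossLMS1991, §1 (p. 235)] -/
theorem descAdmissible_discr_of_forall_silent (hK : IsImaginaryQuadratic K) (hodd : Odd (discr K))
    (hH : SatisfiesHeegnerHypothesis (W.conductorNorm ℤ) K) (h2K : ((Ideal.span {(2 : ℤ)}).primesOver (𝓞 K)).ncard = 2)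
    (hsilent : ∀ (q : ℕ) [Fact q.Prime], (q : ℤ) ∣ discr K → ∀ x : ZMod q,
      4 * x ^ 3 + ((integralModelInt W).b₂ : ZMod q) * x ^ 2 + 2 * ((integralModelInt W).b₄ : ZMod q) * x +
        ((integralModelInt W).b₆ : ZMod q) ≠ 0) :
    DescAdmissible W (discr K) := by
  refine ⟨IsImaginaryQuadratic.discr_neg hK, (discr_squarefree_of_odd hK hodd).1,
    (Quadratic.ncard_primesOver_two_eq_two_iff hK.1).mp h2K, ?_, ?_⟩
  · intro q hq hqd
    haveI := Fact.mk hq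
    have hq2 : q ≠ 2 := by
      rintro rfl
      exact (Int.not_even_iff_odd.mpr hodd) (even_iff_two_dvd.mpr (by exact_mod_cast hqd))
    have hqN : ¬ q ∣ W.conductorNorm ℤ := fun h => Literature.SatisfiesHeegnerHypothesis.not_dvd_discr hK.1 hH hq h hqd
    have hqΔ : ¬ (q : ℤ) ∣ minimalDiscriminantInt W := fun h => hqN (dvd_conductorNorm_of_dvd_minimalDiscriminantInt W hq h)
    exact ⟨fun _ => hasGoodReductionAtPrime_of_not_dvd W q hqΔ,
      (silent_iff_odd_frobeniusTrace W hq2 hqΔ).mp (hsilent q hqd)⟩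
  · intro p hp hp2 hbad
    haveI := Fact.mk hp
    have hpN : p ∣ W.conductorNorm ℤ := (W.dvd_conductorNorm_iff_not_hasGoodReductionAtPrime p).mpr (hbad ⟨hp⟩)
    exact (Quadratic.ncard_primesOver_eq_two_iff_jacobiSym hK.1 hp hp2).mp (hH p hp hpN)

/-- **ROW 1 on `Δ > 0`: the DEF = 1 supply of a Sel₂-minimal twin is ALL-OR-NOTHING in `K`** (mod T-V
`F1Sign2.StrictShaPropagationAtTwo` BY NAME). `W/ℚ` globally minimal elliptic, `Δ_W > 0`, no rational `2`-torsion abscissa, rank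
`0`, `#Sel₂(W) = 4` (WALL row 1). EITHER (ε = +1) EVERY silent prime `ℓ ≡ 7 (8)`, `ℓ ≡ −1 (p ∣ N_W odd)` gives `K = ℚ(√−ℓ)` with
every K-clause of crux 22136, `2` split, `E(ℚ_ℓ)[2] = 0` (DEF = 1) AND a globally minimal twin `Wd` with `#Sel₂(Wd) = 2`; OR
(ε = −1) for EVERY `-desc`-admissible `d` — by `descAdmissible_discr_of_forall_silent` every DEF = 1 Heegner field of `W` —
EVERY elliptic model of `W^{(d)}` has `#Sel₂ = 8 ≠ 2`. The branch is a property of `W` alone (is `Sel₂(W) = Ш(W)[2]` strict at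
the real place?), NOT a Čebotarev condition on the twisting prime — unlike `Δ < 0` (g6 `natCard_selmerGroup_twin_eq_two_iff_not_strict`:
sign `loc_ℓ(Sel₂(W)) ≠ 0`, open in `ℓ`). [cite: Kramer1981, Prop. 6] [cite: MazurRubin2010, Prop. 3.3] [cite: CremonaMazur2000, §3] -/
theorem supply_DEF1_posDisc_rowOne_dichotomy (hV : StrictShaPropagationAtTwo) (hΔ : 0 < W.Δ)
    (ht : NoRationalTwoTorsion W) (hr : W.mordellWeilRank = 0) (h4 : Nat.card (W.selmerGroup 2) = 4) :
    (∀ ⦃ℓ : ℕ⦄, ℓ.Prime → ℓ % 8 = 7 → (∀ p : ℕ, p.Prime → p ∣ W.conductorNorm ℤ → p ≠ 2 → (ℓ : ZMod p) = -1) →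
      (∀ x : ZMod ℓ, 4 * x ^ 3 + ((integralModelInt W).b₂ : ZMod ℓ) * x ^ 2 +
        2 * ((integralModelInt W).b₄ : ZMod ℓ) * x + ((integralModelInt W).b₆ : ZMod ℓ) ≠ 0) →
      ∃ (K : Type) (_ : Field K) (_ : NumberField K), IsImaginaryQuadratic K ∧ discr K = -(ℓ : ℤ) ∧ Odd (discr K) ∧
        discr K ≠ -3 ∧ SatisfiesHeegnerHypothesis (W.conductorNorm ℤ) K ∧
        ¬ IsSquare ((discr K : ℚ) * -|W.Δ|) ∧ ¬ IsSquare ((discr K : ℚ) * (-(2 * |W.Δ|))) ∧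
        ((Ideal.span {(2 : ℤ)}).primesOver (𝓞 K)).ncard = 2 ∧
        (∀ [Fact ℓ.Prime], ∀ Q : (W.baseChange ℚ_[ℓ]).toAffine.Point, 2 • Q = 0 → Q = 0) ∧
        ∃ (Wd : WeierstrassCurve ℚ) (_ : Wd.IsElliptic) (_ : Wd.IsGloballyMinimal),
          (∃ C : VariableChange ℚ, C • W.quadraticTwist (discr K : ℚ) = Wd) ∧ Nat.card (Wd.selmerGroup 2) = 2) ∨
    (∀ d : ℤ, DescAdmissible W d → ∀ (Wd : WeierstrassCurve ℚ) [Wd.IsElliptic],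
      (∃ C : VariableChange ℚ, C • W.quadraticTwist (d : ℚ) = Wd) → Nat.card (Wd.selmerGroup 2) = 8) := by
  rcases hV W hΔ ht hr (by rw [selmerTwoCard, h4]) with hall | hall
  · left
    intro ℓ hℓ hℓ8 hℓN hsilent
    obtain ⟨hDA, hloc, K, _, _, hK, hd, hodd, hd3, hH, h2K, hsq1, hsq2⟩ :=
      exists_silent_heegnerField_of_prime W hℓ hℓ8 hℓN hsilent
    have htwist : twistSelmerTwoCard W (-(ℓ : ℤ)) = 2 := hall _ hDA
    have hd0 : ((discr K : ℤ) : ℚ) ≠ 0 := by exact_mod_cast NumberField.discr_ne_zero K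
    haveI := W.isElliptic_quadraticTwist hd0
    obtain ⟨C, hC⟩ := hasGlobalMinimalModel_rat_holds (W.quadraticTwist ((discr K : ℤ) : ℚ))
    haveI := hC
    refine ⟨K, inferInstance, inferInstance, hK, hd, hodd, hd3, hH, hsq1, hsq2, h2K, hloc,
      C • W.quadraticTwist ((discr K : ℤ) : ℚ), inferInstance, hC, ⟨C, rfl⟩, ?_⟩
    rw [natCard_selmerGroup_model_eq_twistSelmerTwoCard W (NumberField.discr_ne_zero K) _ ⟨C, rfl⟩, hd, htwist]
  · right
    intro d hd Wd _ hWd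
    rw [natCard_selmerGroup_model_eq_twistSelmerTwoCard W hd.1.ne Wd hWd, hall d hd]

/-- **The ε = −1 branch is the `-an`/`-desc` descent sign `F1Sign2.DescentSignNeg W`** (∃ an admissible `d` whose twist
DOUBLES `#Sel₂`): under T-V, on row 1 with `Δ > 0`, `DescentSignNeg W` forces `#Sel₂ = 8` for EVERY admissible twist — so NO
DEF = 1 Heegner field of `W` has a Sel₂-minimal twin (`8 ≠ 2`): these cells are outside the reach of every re-typing of crux
22136 / item 24947 that keeps «DEF(W,K) = 1 ∧ #Sel₂(Wd) = 2 at the same K» (CONSISTENCY FINDING #3; the habitat clause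
`Nat.card (W.selmerGroup 2) ≤ 4` of FINDING #2 does not remove them). [cite: Kramer1981, Prop. 6] [cite: CremonaMazur2000, §3] -/
theorem no_minimalTwin_of_descentSignNeg (hV : StrictShaPropagationAtTwo) (hΔ : 0 < W.Δ)
    (ht : NoRationalTwoTorsion W) (hr : W.mordellWeilRank = 0) (h4 : Nat.card (W.selmerGroup 2) = 4)
    (hε : DescentSignNeg W) (hK : IsImaginaryQuadratic K) (hodd : Odd (discr K))
    (hH : SatisfiesHeegnerHypothesis (W.conductorNorm ℤ) K) (h2K : ((Ideal.span {(2 : ℤ)}).primesOver (𝓞 K)).ncard = 2)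
    (hsilent : ∀ (q : ℕ) [Fact q.Prime], (q : ℤ) ∣ discr K → ∀ x : ZMod q,
      4 * x ^ 3 + ((integralModelInt W).b₂ : ZMod q) * x ^ 2 + 2 * ((integralModelInt W).b₄ : ZMod q) * x +
        ((integralModelInt W).b₆ : ZMod q) ≠ 0)
    (Wd : WeierstrassCurve ℚ) [Wd.IsElliptic] (hWd : ∃ C : VariableChange ℚ, C • W.quadraticTwist (discr K : ℚ) = Wd) :
    Nat.card (Wd.selmerGroup 2) = 8 := by
  have hDA := descAdmissible_discr_of_forall_silent W hK hodd hH h2K hsilent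
  obtain ⟨d₀, hd₀, h2x⟩ := hε
  rw [selmerTwoCard, h4] at h2x
  rcases hV W hΔ ht hr (by rw [selmerTwoCard, h4]) with hall | hall
  · -- every admissible twist would have `#Sel₂ = 2`, but `d₀` doubles: `2 = 8`
    have h2 := hall d₀ hd₀
    omega
  · rw [natCard_selmerGroup_model_eq_twistSelmerTwoCard W (NumberField.discr_ne_zero K) Wd hWd, hall _ hDA]


/-! ## §5. Habitat dictionary: the hypotheses of §3–§4 on the habitat of crux 22136 -/

omit [W.IsGloballyMinimal] in
/-- **`ρ̄_{E,2}` onto ⟹ no rational `2`-torsion abscissa** (the habitat clause `∀ n ≥ 1, ρ_{E,2^n}` onto at `n = 1` gives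
`E[2]` irreducible, hence `#E(ℚ)[2] = 1` — Mazur; a rational point `(x, y)` with `2y + a₁x + a₃ = 0` would be a point of order
`2`). This is the hypothesis `F1Sign2.NoRationalTwoTorsion W` of the `-desc` statements T-A / T-V.
[cite: SilvermanAEC2009, III.2.3(d)] [cite: Mazur1977, Ch. III §5, p. 157] -/
theorem noRationalTwoTorsion_of_hasSurjectiveModNGaloisRep (hsurj : W.HasSurjectiveModNGaloisRep ((2 : ℤ) ^ 1)) :
    NoRationalTwoTorsion W := by
  haveI : Fact (Nat.Prime 2) := ⟨Nat.prime_two⟩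
  haveI : NeZero ((2 : ℕ) : ℚ) := ⟨by norm_num⟩
  have hirr := hasIrreducibleModPGaloisRep_of_hasSurjectiveModNGaloisRep W 2 (by simpa using hsurj)
  have hcard := natCard_torsionBy_eq_one_of_hasIrreducibleModPGaloisRep W 2 hirr
  rintro x ⟨y, hxy, h2⟩
  have hns : W.toAffine.Nonsingular x y := (Affine.equation_iff_nonsingular (W := W)).mp hxy
  have hP2 : (Affine.Point.some x y hns : W.toAffine.Point) + Affine.Point.some x y hns = 0 :=
    Affine.Point.add_self_of_Y_eq (by rw [Affine.negY]; linear_combination h2)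
  have hmem : (Affine.Point.some x y hns : W.toAffine.Point) ∈ AddSubgroup.torsionBy W.toAffine.Point ((2 : ℕ) : ℤ) := by
    rw [Submodule.mem_toAddSubgroup, Submodule.mem_torsionBy_iff, Nat.cast_ofNat, two_zsmul]
    exact hP2
  haveI := (Nat.card_eq_one_iff_unique.mp hcard).1
  have h0 : (⟨Affine.Point.some x y hns, hmem⟩ : AddSubgroup.torsionBy W.toAffine.Point ((2 : ℕ) : ℤ)) =
      ⟨0, AddSubgroup.zero_mem _⟩ := Subsingleton.elim _ _
  exact Affine.Point.some_ne_zero hns (congrArg Subtype.val h0)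

/-- **Row 1 of the habitat, `Δ > 0`, ε = −1: no DEF = 1 field has a Sel₂-minimal twin — under the binders of crux 22136**
(`r_an(W) = 0` with the Gross–Zagier–Kolyvagin fact `rank_eq_analyticRank_of_analyticRank_le_one` = item 19921 BY NAME,
`ρ_{W,2^n}` onto for `n ≥ 1`, `#Sel₂(W) = 4` = WALL row 1; T-V BY NAME): for every admissible Heegner field `K` with `2` split
and all primes of `d_K` silent, every elliptic model of `W^{(d_K)}` has `#Sel₂ = 8`. (CONSISTENCY FINDING #3 in the crux's
own binders.) [cite: Kramer1981, Prop. 6] [cite: CremonaMazur2000, §3] -/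
theorem no_minimalTwin_of_descentSignNeg_habitat (hV : StrictShaPropagationAtTwo)
    (hGZK : rank_eq_analyticRank_of_analyticRank_le_one) (hΔ : 0 < W.Δ) (hr0 : W.analyticRank = 0)
    (hρ : ∀ n : ℕ, 0 < n → W.HasSurjectiveModNGaloisRep ((2 : ℤ) ^ n)) (h4 : Nat.card (W.selmerGroup 2) = 4)
    (hε : DescentSignNeg W) (hK : IsImaginaryQuadratic K) (hodd : Odd (discr K))
    (hH : SatisfiesHeegnerHypothesis (W.conductorNorm ℤ) K) (h2K : ((Ideal.span {(2 : ℤ)}).primesOver (𝓞 K)).ncard = 2)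
    (hsilent : ∀ (q : ℕ) [Fact q.Prime], (q : ℤ) ∣ discr K → ∀ x : ZMod q,
      4 * x ^ 3 + ((integralModelInt W).b₂ : ZMod q) * x ^ 2 + 2 * ((integralModelInt W).b₄ : ZMod q) * x +
        ((integralModelInt W).b₆ : ZMod q) ≠ 0)
    (Wd : WeierstrassCurve ℚ) [Wd.IsElliptic] (hWd : ∃ C : VariableChange ℚ, C • W.quadraticTwist (discr K : ℚ) = Wd) :
    Nat.card (Wd.selmerGroup 2) = 8 :=
  have hr : W.mordellWeilRank = 0 := by rw [(hGZK W (by rw [hr0]; exact zero_le_one)).1, hr0]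
  no_minimalTwin_of_descentSignNeg W hV hΔ (noRationalTwoTorsion_of_hasSurjectiveModNGaloisRep W (hρ 1 one_pos)) hr h4 hε
    hK hodd hH h2K hsilent Wd hWd

/-- **`{Δ > 0, Ш[2] = 0}` on the habitat: the supply of §3 under the binders of crux 22136** (`r_an = 0` + GZK BY NAME,
`ρ_{W,2^n}` onto, `Ш(W)[2] = 0` ⟹ `#Sel₂(W) = 1` by the descent count; then T-A BY NAME): every silent admissible prime gives a
DEF = 1 field with ALL K-clauses of the crux and a globally minimal Sel₂-minimal twin. The twin's analytic rank one is NOT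
asserted (it is the rank-one `2`-converse / Gross–Zagier–Kolyvagin, as for stub A). [cite: SilvermanAEC2009, Thm. X.4.2] -/
theorem supply_DEF1_posDisc_of_shift_habitat (hA : AdmissibleTwistSelmerShiftAtTwo)
    (hGZK : rank_eq_analyticRank_of_analyticRank_le_one) (hΔ : 0 < W.Δ) (hr0 : W.analyticRank = 0)
    (hρ : ∀ n : ℕ, 0 < n → W.HasSurjectiveModNGaloisRep ((2 : ℤ) ^ n))
    (hsha : Nat.card (W.sha ⊓ AddSubgroup.torsionBy W.galH1 ((2 : ℕ) : ℤ) : AddSubgroup W.galH1) = 1)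
    {ℓ : ℕ} (hℓ : ℓ.Prime) (hℓ8 : ℓ % 8 = 7)
    (hℓN : ∀ p : ℕ, p.Prime → p ∣ W.conductorNorm ℤ → p ≠ 2 → (ℓ : ZMod p) = -1)
    (hsilent : ∀ x : ZMod ℓ, 4 * x ^ 3 + ((integralModelInt W).b₂ : ZMod ℓ) * x ^ 2 +
        2 * ((integralModelInt W).b₄ : ZMod ℓ) * x + ((integralModelInt W).b₆ : ZMod ℓ) ≠ 0) :
    ∃ (K : Type) (_ : Field K) (_ : NumberField K), IsImaginaryQuadratic K ∧ discr K = -(ℓ : ℤ) ∧ Odd (discr K) ∧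
      discr K ≠ -3 ∧ SatisfiesHeegnerHypothesis (W.conductorNorm ℤ) K ∧
      ¬ IsSquare ((discr K : ℚ) * -|W.Δ|) ∧ ¬ IsSquare ((discr K : ℚ) * (-(2 * |W.Δ|))) ∧
      ((Ideal.span {(2 : ℤ)}).primesOver (𝓞 K)).ncard = 2 ∧
      (∀ [Fact ℓ.Prime], ∀ Q : (W.baseChange ℚ_[ℓ]).toAffine.Point, 2 • Q = 0 → Q = 0) ∧
      ∃ (Wd : WeierstrassCurve ℚ) (_ : Wd.IsElliptic) (_ : Wd.IsGloballyMinimal),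
        (∃ C : VariableChange ℚ, C • W.quadraticTwist (discr K : ℚ) = Wd) ∧ Nat.card (Wd.selmerGroup 2) = 2 :=
  supply_DEF1_posDisc_of_shift W hA hΔ (noRationalTwoTorsion_of_hasSurjectiveModNGaloisRep W (hρ 1 one_pos))
    (natCard_selmerGroup_two_eq_one_of_analyticRank_zero hGZK W hr0 (hρ 1 one_pos) hsha) hℓ hℓ8 hℓN hsilent

end Summit.BirchSwinnertonDyer.BirchSwinnertonDyer.Theorems.GenusKolyTwin
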